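import Literature.NumberTheory.Automorphic.UnitaryGroupFrameStabiliserLevel
import Literature.AlgebraicGeometry.ShimuraVarieties.UnitaryShimuraCurveEmbeddingPoints
import HarnessLib

/-!
# The level junction of the embedded unitary Shimura curve: arithmetic levels of the curve and of the surface pieces
# along a translated frame (road (ii), the `hΓ₁Γ` / `hΓΓ₁` clauses of leaf L3.3 in trace-pair `L`-currency)

Topic `AlgebraicGeometry/ShimuraVarieties`, namespace `…ShimuraVarieties.UnitaryCanonicalModel`.  THEOREMS ONLY (no definition,
no named fact, no instance, no `sorry`).  Cell `hodgecm-mathlib`, road (ii) «embedded-curve descent», leaf L3.3 F-REIDX (the two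
group-theoretic junction hypotheses of ★ `UnitaryBallUniformisationDatum.exists_specialCurveDatum_of_subfieldCode′`); books 0.

SETTING.  A CM field `L`, hermitian `H ∈ M₃(L)`, a frame `ᵗ(cB)·(a·H)·B = J⋆ ⊕ J⊥` (`B ∈ GL₃(L)`), the finite-adelic embedding
`φGS : u ↦ R_B(u ⊕ 1)` of `U(J⋆)(𝔸_{L⁺,f})` into `U(H)(𝔸_{L⁺,f})` (★ `UnitaryShimuraCurveRecord`), a TRACE PAIR of levels
`(K⋆, K)` — `φGS(K⋆) ≤ K` and, for the converse junction, `φGS⁻¹(K) ≤ K⋆` — a representative `g⋆` of a double coset of the curve, the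
representative `g` of the surface double coset it lands in and its rational BOOKKEEPER `γ ∈ U(H)(L⁺)` with `g⁻¹·γ_f·φGS(g⋆) ∈ K`
(★ `exists_rational_smul_rep_mem`).  Write `Γ⋆ := Γ_{J⋆}(g⋆ K⋆ g⋆⁻¹)` (★ `arithmeticLevel`) for the curve's arithmetic level at `g⋆` and
`Γ := Γ_H(g K g⁻¹)` for the surface's at `g`; the special curve of the class of `g⋆` inside the piece of `g` is cut out by the translated
frame `γ·B`.

RESULTS.
* `conj_frame_blockDiag_mem_arithmeticLevel_of_rep` — **`hΓ₁Γ`: `(γB)(γ₁ ⊕ 1)(γB)⁻¹ ∈ Γ` for every `γ₁ ∈ Γ⋆`**: the element is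
  `γ · B(γ₁ ⊕ 1)B⁻¹ · γ⁻¹` with `B(γ₁ ⊕ 1)B⁻¹ = embRational γ₁ ∈ U(H)(L⁺)` (★ `embRational`), and on the finite adeles
  `g⁻¹ (γ_f φGS(γ₁,f) γ_f⁻¹) g = k·φGS(g⋆⁻¹ γ₁,f g⋆)·k⁻¹ ∈ K` for `k := g⁻¹ γ_f φGS(g⋆) ∈ K` (★ `rationalToFinAdelic_embRational_eq_φGS`).
* `exists_mem_arithmeticLevel_eq_conj_frame_blockDiag` — **`hΓΓ₁`: every `δ ∈ Γ` carrying the plane `(γB)(L² ⊕ 0)` into itself is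
  `(γB)(γ₁ ⊕ 1)(γB)⁻¹` with `γ₁ ∈ Γ⋆`**, provided `K` lies in a `B`-adapted principal level `K_B(n)`, `n ≥ 3`, and `φGS⁻¹(K) ≤ K⋆`:
  ★ (F-A) `exists_eq_embRational_of_mulVec_frameEmb_of_mem_level_cm` ([Deligne1971TravauxShimura] Prop. 1.15, case (A): the
  `U(1)`-part on the line is a norm-one unit `≡ 1 (mod n)`, hence `1`) applied to `γ⁻¹ δ γ` with the coset datum `u = u′ = g⋆`, and
  the trace clause for the membership `γ₁ ∈ Γ⋆`.

These are the per-class inputs of the L3.3 package consumed by the road-(ii) head ★ `exists_recordSystemGS_of_recordSystem`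
(`UnitaryShimuraCurveRecordOfEmbedding`).

## References
* [Deligne1971TravauxShimura] P. Deligne, *Travaux de Shimura*, Sém. Bourbaki 389 (1971), Prop. 1.15 and its proof pp. 132–133.
* [Milne2005ShimuraVarieties] J. S. Milne, *Introduction to Shimura varieties* (2005/2017), Lemma 5.13 p. 57, Thm. 5.16 p. 59.
* [PlatonovRapinchuk1994] V. Platonov, A. Rapinchuk, *Algebraic Groups and Number Theory* (1994), §4.1 (arithmetic subgroups
  `G(ℚ) ∩ K`, conjugates), §2.3.
* [Liu2021] Y. Liu, Camb. J. Math. 9 (2021), proof of Thm. 4.15 (FJcycle.tex l. 2193–2208).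
-/

set_option autoImplicit false

noncomputable section

open Function MulAction NumberField Matrix
open scoped Matrix
open Literature.NumberTheory.Automorphic Literature.NumberTheory.Automorphic.UnitaryGroup

namespace Literature.AlgebraicGeometry.ShimuraVarieties.UnitaryCanonicalModel

variable (L : Type) [Field L] [NumberField L] [IsCMField L]
  (H : Matrix (Fin 3) (Fin 3) L) (Jstar : Matrix (Fin 2) (Fin 2) L) (Jperp : Matrix (Fin 1) (Fin 1) L) (B : GL (Fin 3) L)
  {a : L} (ha : a ≠ 0)
  (hB : formCongr ((IsCMField.complexConj L : L ≃ₐ[↥(maximalRealSubfield L)] L) : L →+* L) B (a • H) = finSum 2 1 Jstar Jperp)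

/-- **`hΓ₁Γ` in trace-pair currency: `(γB)(γ₁ ⊕ 1)(γB)⁻¹ ∈ Γ_H(gKg⁻¹)` for every `γ₁ ∈ Γ_{J⋆}(g⋆K⋆g⋆⁻¹)`**, for a bookkeeper
`γ ∈ U(H)(L⁺)` with `g⁻¹·γ_f·φGS(g⋆) ∈ K` and `φGS(K⋆) ≤ K`. [cite: PlatonovRapinchuk1994, §4.1] [cite: Milne2005ShimuraVarieties, Lemma 5.13 p. 57] -/
theorem conj_frame_blockDiag_mem_arithmeticLevel_of_rep
    {Kstar : Subgroup ↥(finAdelic (↥(maximalRealSubfield L)) L (IsCMField.complexConj L) 2 Jstar)}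
    {K : Subgroup ↥(finAdelic (↥(maximalRealSubfield L)) L (IsCMField.complexConj L) 3 H)}
    (hK : Kstar.map (φGS L Jstar Jperp H B ha hB) ≤ K)
    (gq : ↥(finAdelic (↥(maximalRealSubfield L)) L (IsCMField.complexConj L) 3 H))
    (gs : ↥(finAdelic (↥(maximalRealSubfield L)) L (IsCMField.complexConj L) 2 Jstar))
    (γr : ↥(rational (↥(maximalRealSubfield L)) L (IsCMField.complexConj L) 3 H))
    (hγ : gq⁻¹ * (rationalToFinAdelic (↥(maximalRealSubfield L)) L (IsCMField.complexConj L) 3 H γr *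
      φGS L Jstar Jperp H B ha hB gs) ∈ K)
    {γ₁ : GL (Fin 2) L}
    (hγ₁ : γ₁ ∈ arithmeticLevel (↥(maximalRealSubfield L)) L (IsCMField.complexConj L) 2 Jstar
      (Kstar.map (MulAut.conj gs).toMonoidHom)) :
    ((γr : GL (Fin 3) L) * B) * reindexGL finSumFinEquiv (blockDiagGL (γ₁, (1 : GL (Fin 1) L))) * ((γr : GL (Fin 3) L) * B)⁻¹ ∈
      arithmeticLevel (↥(maximalRealSubfield L)) L (IsCMField.complexConj L) 3 H (K.map (MulAut.conj gq).toMonoidHom) := by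
  obtain ⟨hγ₁r, hγ₁K⟩ := mem_arithmeticLevel_iff.1 hγ₁
  set γ₁' : ↥(rational (↥(maximalRealSubfield L)) L (IsCMField.complexConj L) 2 Jstar) := ⟨γ₁, hγ₁r⟩ with hγ₁'
  -- the element is the rational `γ · embRational γ₁ · γ⁻¹`
  set x : ↥(rational (↥(maximalRealSubfield L)) L (IsCMField.complexConj L) 3 H) :=
    γr * embRational (↥(maximalRealSubfield L)) L (IsCMField.complexConj L) 2 1 Jstar Jperp H B ha hB γ₁' * γr⁻¹ with hx
  have hxe : ((γr : GL (Fin 3) L) * B) * reindexGL finSumFinEquiv (blockDiagGL (γ₁, (1 : GL (Fin 1) L))) *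
      ((γr : GL (Fin 3) L) * B)⁻¹ = (x : GL (Fin 3) L) := by
    rw [hx, Subgroup.coe_mul, Subgroup.coe_mul, Subgroup.coe_inv, coe_embRational_eq_reindexGL]
    simp only [_root_.mul_inv_rev, mul_assoc]
    rfl
  rw [hxe]
  refine mem_arithmeticLevel_iff.2 ⟨x.2, ?_⟩
  have hxx : (⟨(x : GL (Fin 3) L), x.2⟩ : ↥(rational (↥(maximalRealSubfield L)) L (IsCMField.complexConj L) 3 H)) = x :=
    Subtype.ext rfl
  rw [hxx, Subgroup.mem_map_equiv, MulAut.conj_symm_apply, hx, map_mul, map_mul, map_inv,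
    rationalToFinAdelic_embRational_eq_φGS]
  -- `g⋆⁻¹ γ₁,f g⋆ ∈ K⋆`, hence `φGS` of it lies in `K`
  have h1 : gs⁻¹ * rationalToFinAdelic (↥(maximalRealSubfield L)) L (IsCMField.complexConj L) 2 Jstar γ₁' * gs ∈ Kstar := by
    have h := hγ₁K
    rw [Subgroup.mem_map_equiv, MulAut.conj_symm_apply] at h
    exact h
  have h2 : φGS L Jstar Jperp H B ha hB
      (gs⁻¹ * rationalToFinAdelic (↥(maximalRealSubfield L)) L (IsCMField.complexConj L) 2 Jstar γ₁' * gs) ∈ K :=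
    hK (Subgroup.mem_map_of_mem _ h1)
  -- `g⁻¹ (γ_f φGS(γ₁,f) γ_f⁻¹) g = k · φGS(g⋆⁻¹ γ₁,f g⋆) · k⁻¹`
  have key : gq⁻¹ * (rationalToFinAdelic (↥(maximalRealSubfield L)) L (IsCMField.complexConj L) 3 H γr *
      φGS L Jstar Jperp H B ha hB (rationalToFinAdelic (↥(maximalRealSubfield L)) L (IsCMField.complexConj L) 2 Jstar γ₁') *
      (rationalToFinAdelic (↥(maximalRealSubfield L)) L (IsCMField.complexConj L) 3 H γr)⁻¹) * gq =
      (gq⁻¹ * (rationalToFinAdelic (↥(maximalRealSubfield L)) L (IsCMField.complexConj L) 3 H γr *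
        φGS L Jstar Jperp H B ha hB gs)) *
      φGS L Jstar Jperp H B ha hB
        (gs⁻¹ * rationalToFinAdelic (↥(maximalRealSubfield L)) L (IsCMField.complexConj L) 2 Jstar γ₁' * gs) *
      (gq⁻¹ * (rationalToFinAdelic (↥(maximalRealSubfield L)) L (IsCMField.complexConj L) 3 H γr *
        φGS L Jstar Jperp H B ha hB gs))⁻¹ := by
    rw [map_mul, map_mul, map_inv]
    group
  rw [key]
  exact K.mul_mem (K.mul_mem hγ h2) (K.inv_mem hγ)

/-- **`hΓΓ₁` in trace-pair currency ([Deligne1971TravauxShimura] Prop. 1.15, case (A), at the translated frame)**: for a trace pair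
`φGS(K⋆) ≤ K`, `φGS⁻¹(K) ≤ K⋆` with `K` inside the `B`-adapted principal level `K_B(n)`, `n ≥ 3`, a bookkeeper `γ` of `(g⋆, g)` and
`det J⋆, det J⊥ ≠ 0`: every `δ ∈ Γ_H(gKg⁻¹)` with `δ·(γB)(x ⊕ 0) ∈ (γB)(L² ⊕ 0)` for all `x` is `(γB)(γ₁ ⊕ 1)(γB)⁻¹` for some
`γ₁ ∈ Γ_{J⋆}(g⋆K⋆g⋆⁻¹)` — ★ (F-A) `exists_eq_embRational_of_mulVec_frameEmb_of_mem_level_cm` for `γ⁻¹δγ` at the frame `B` with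
the coset datum `u = u′ = g⋆`. [cite: Deligne1971TravauxShimura, Prop. 1.15 (proof, pp. 132–133)]
[cite: Milne2005ShimuraVarieties, Thm. 5.16 and Lemma 5.13 p. 57] -/
theorem exists_mem_arithmeticLevel_eq_conj_frame_blockDiag
    (hJstar : Jstar.det ≠ 0) (hJperp : Jperp.det ≠ 0) {n : ℕ} (hn : 3 ≤ n)
    {Kstar : Subgroup ↥(finAdelic (↥(maximalRealSubfield L)) L (IsCMField.complexConj L) 2 Jstar)}
    {K : Subgroup ↥(finAdelic (↥(maximalRealSubfield L)) L (IsCMField.complexConj L) 3 H)}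
    (hKB : K ≤ (finCongruenceLevel (↥(maximalRealSubfield L)) L (IsCMField.complexConj L) 3 (finSum 2 1 Jstar Jperp)
      (Ideal.span {(n : 𝓞 L)})).map (finAdelicCongr (↥(maximalRealSubfield L)) L (IsCMField.complexConj L) B ha hB).toMonoidHom)
    (htrace : K.comap (φGS L Jstar Jperp H B ha hB) ≤ Kstar)
    (gq : ↥(finAdelic (↥(maximalRealSubfield L)) L (IsCMField.complexConj L) 3 H))
    (gs : ↥(finAdelic (↥(maximalRealSubfield L)) L (IsCMField.complexConj L) 2 Jstar))
    (γr : ↥(rational (↥(maximalRealSubfield L)) L (IsCMField.complexConj L) 3 H))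
    (hγ : gq⁻¹ * (rationalToFinAdelic (↥(maximalRealSubfield L)) L (IsCMField.complexConj L) 3 H γr *
      φGS L Jstar Jperp H B ha hB gs) ∈ K)
    {δ : GL (Fin 3) L}
    (hδ : δ ∈ arithmeticLevel (↥(maximalRealSubfield L)) L (IsCMField.complexConj L) 3 H (K.map (MulAut.conj gq).toMonoidHom))
    (hV : ∀ x : Fin 2 → L, ∃ y : Fin 2 → L,
      (δ : Matrix (Fin 3) (Fin 3) L) *ᵥ ((((γr : GL (Fin 3) L) * B : GL (Fin 3) L) : Matrix (Fin 3) (Fin 3) L) *ᵥ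
          Fin.append x (0 : Fin 1 → L)) =
        (((γr : GL (Fin 3) L) * B : GL (Fin 3) L) : Matrix (Fin 3) (Fin 3) L) *ᵥ Fin.append y (0 : Fin 1 → L)) :
    ∃ γ₁ ∈ arithmeticLevel (↥(maximalRealSubfield L)) L (IsCMField.complexConj L) 2 Jstar
        (Kstar.map (MulAut.conj gs).toMonoidHom),
      δ = ((γr : GL (Fin 3) L) * B) * reindexGL finSumFinEquiv (blockDiagGL (γ₁, (1 : GL (Fin 1) L))) * ((γr : GL (Fin 3) L) * B)⁻¹ := by
  obtain ⟨hδr, hδK⟩ := mem_arithmeticLevel_iff.1 hδ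
  -- `δ′ := γ⁻¹ δ γ ∈ U(H)(L⁺)`
  set δ' : ↥(rational (↥(maximalRealSubfield L)) L (IsCMField.complexConj L) 3 H) := γr⁻¹ * ⟨δ, hδr⟩ * γr with hδ'
  have hδ'coe : ((δ' : GL (Fin 3) L) : Matrix (Fin 3) (Fin 3) L) =
      ((γr : GL (Fin 3) L)⁻¹ : GL (Fin 3) L) * (δ : Matrix (Fin 3) (Fin 3) L) * ((γr : GL (Fin 3) L) : Matrix (Fin 3) (Fin 3) L) := by
    rw [hδ', Subgroup.coe_mul, Subgroup.coe_mul, Subgroup.coe_inv, Units.val_mul, Units.val_mul]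
  -- `δ′` carries `B(L² ⊕ 0)` into itself
  have hV' : ∀ x : Fin 2 → L, ∃ y : Fin 2 → L,
      ((δ' : GL (Fin 3) L) : Matrix (Fin 3) (Fin 3) L) *ᵥ ((B : Matrix (Fin 3) (Fin 3) L) *ᵥ Fin.append x (0 : Fin 1 → L)) =
        (B : Matrix (Fin 3) (Fin 3) L) *ᵥ Fin.append y (0 : Fin 1 → L) := by
    intro x
    obtain ⟨y, hy⟩ := hV x
    refine ⟨y, ?_⟩
    rw [Units.val_mul, ← mulVec_mulVec, ← mulVec_mulVec] at hy
    rw [hδ'coe, ← mulVec_mulVec, ← mulVec_mulVec, hy, mulVec_mulVec, Units.inv_mul, one_mulVec]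
  -- the coset datum at `u = u′ = g⋆`: `φGS(g⋆)⁻¹ δ′_f φGS(g⋆) = k⁻¹ (g⁻¹ δ_f g) k ∈ K`
  have hδK' : gq⁻¹ * rationalToFinAdelic (↥(maximalRealSubfield L)) L (IsCMField.complexConj L) 3 H ⟨δ, hδr⟩ * gq ∈ K := by
    have h := hδK
    rw [Subgroup.mem_map_equiv, MulAut.conj_symm_apply] at h
    exact h
  have hcoset : (φGS L Jstar Jperp H B ha hB gs)⁻¹ *
      (rationalToFinAdelic (↥(maximalRealSubfield L)) L (IsCMField.complexConj L) 3 H δ' * φGS L Jstar Jperp H B ha hB gs) ∈ K := by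
    have key : (φGS L Jstar Jperp H B ha hB gs)⁻¹ *
        (rationalToFinAdelic (↥(maximalRealSubfield L)) L (IsCMField.complexConj L) 3 H δ' * φGS L Jstar Jperp H B ha hB gs) =
        (gq⁻¹ * (rationalToFinAdelic (↥(maximalRealSubfield L)) L (IsCMField.complexConj L) 3 H γr *
          φGS L Jstar Jperp H B ha hB gs))⁻¹ *
        (gq⁻¹ * rationalToFinAdelic (↥(maximalRealSubfield L)) L (IsCMField.complexConj L) 3 H ⟨δ, hδr⟩ * gq) *
        (gq⁻¹ * (rationalToFinAdelic (↥(maximalRealSubfield L)) L (IsCMField.complexConj L) 3 H γr *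
          φGS L Jstar Jperp H B ha hB gs)) := by
      rw [hδ', map_mul, map_mul, map_inv]
      group
    rw [key]
    exact K.mul_mem (K.mul_mem (K.inv_mem hγ) hδK') hγ
  -- case (A): `δ′ = embRational γ⋆`
  obtain ⟨γs, hγs⟩ := exists_eq_embRational_of_mulVec_frameEmb_of_mem_level_cm 2 L Jstar Jperp H B ha hB hJstar hJperp hn
    (φGS_apply L Jstar Jperp H B ha hB) hKB δ' gs gs hV' hcoset
  refine ⟨(γs : GL (Fin 2) L), ?_, ?_⟩
  · -- `γ⋆ ∈ Γ_{J⋆}(g⋆K⋆g⋆⁻¹)` by the trace clause: `φGS(g⋆⁻¹ γ⋆,f g⋆) = φGS(g⋆)⁻¹ δ′_f φGS(g⋆) ∈ K`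
    refine mem_arithmeticLevel_iff.2 ⟨γs.2, ?_⟩
    have hγs' : (⟨(γs : GL (Fin 2) L), γs.2⟩ : ↥(rational (↥(maximalRealSubfield L)) L (IsCMField.complexConj L) 2 Jstar)) = γs :=
      Subtype.ext rfl
    rw [hγs', Subgroup.mem_map_equiv, MulAut.conj_symm_apply]
    apply htrace
    rw [Subgroup.mem_comap, map_mul, map_mul, map_inv, ← rationalToFinAdelic_embRational_eq_φGS, ← hγs, mul_assoc]
    exact hcoset
  · -- `δ = γ δ′ γ⁻¹ = (γB)(γ⋆ ⊕ 1)(γB)⁻¹`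
    have hδeq : δ = (γr : GL (Fin 3) L) * (δ' : GL (Fin 3) L) * ((γr : GL (Fin 3) L))⁻¹ := by
      rw [hδ', Subgroup.coe_mul, Subgroup.coe_mul, Subgroup.coe_inv]
      group
    rw [hδeq, hγs, coe_embRational_eq_reindexGL]
    simp only [_root_.mul_inv_rev, mul_assoc]

end Literature.AlgebraicGeometry.ShimuraVarieties.UnitaryCanonicalModel

end
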